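import Summits.QuantumFields.YangMills.Theorems.BalabanUVNodesN15CurvedCubeTransplant
import Summits.QuantumFields.YangMills.Theorems.BalabanUVNodesN15BackwardShift
import Summits.QuantumFields.YangMills.Theorems.BalabanUVNodesN15TwoGridLocality
import HarnessLib

/-!
# Route «BalabanUVNodes» (cluster K4 «SpineRates»), Track-A DAG node N15 = NE2, BACKGROUND LAYER — THE LATTICE GRADIENT PAST A TRANSPLANTED CUBE OPERATOR: `∇_glob ∘ (ε T ρ)
# = ε (∇_cube ∘ T) ρ + BOUNDARY`, the boundary operator EXACT (two pieces on the one-step layer of the window), KILLED by any partition function vanishing on that layer, and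
# majorised from the cube's own letters through a one-step block-displacement letter — (2.133) read on the global lattice for the derivative entries

Cell `pub-ymgap`, WIDTH SEAT `pub-ymgap-dag-n15-w2` (director-ym №197 ∕ HUMAN RULING D-0149), generation 3, file 2 = dag-n15-w3 g3's located piece (c) (pub-ymgap INBOX l.28190,
«what IS open on my road for a fresh hand: … (c) the transplant ∕ global-derivative compatibility for g2's file 11»).  `bears_on: R4∕N15 · K3⁷ SpineGivenEndpointR13SepCoPH
(stmt-QuantumFields-20544)`.  Filed `--kind proof --supports stmt-QuantumFields-20544 --as helper` — COUNT-NEUTRAL; theorems only (0 `def`, 0 `sorry`).  Imports BY NAME dag-n15-w3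
g2's file 11 `…N15CurvedCubeTransplant` (p595682 lineage: `windowInd`, `hasMaj_transplant`; through it lit `B6Prop26ReachTransplant`: `transplant`, `extendOp`, `restrictOp`,
`transplant_apply`), dag-n15-a's `…N15BackwardShift` (`VectorPiece.hasMaj_pull_comp`, `tdistT_blockOf_sub_unitVec_le`) and `…N15TwoGridLocality` (`TwoGrid.hasMaj_smul_ofBlocks`),
dag-n15-c g8's `BackgroundLayer.fgrad ∕ bgrad` (through file 11), lit `B6Prop26Gluing.mulOp`, `T4EtaRateCoeffDefect.pull`; nothing re-declared.

WHY.  [Balaban1984PropagatorsII] p. 238–239 identifies the enlarged cube `□̃³ ⊂ T_η` with a torus `T_□` and reads `G_□` on the global lattice through `G₀ = Σ_□ h_□G_□h_□`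
((2.90)–(2.91)); (2.133) p. 247 states the letters of `G_□` AND OF ITS COVARIANT DERIVATIVES there.  File 11 (`transplant W e T = ε ∘ T ∘ ρ`, window `W`, chart `e`) carried
majorants and η-defects of `T` itself; the DERIVATIVE entries of the gluing (dag-n15-c's `hD` rows, dag-n15-w3's left∕right entries) need the global difference quotient
`∇ = n(S_E − 1)` of the transplanted operator, while the cube supplies `∇_□ = n(S_{E′} − 1)` on its own lattice.  The two differ by a BOUNDARY operator on the one-step layer
`{x ∉ W, Ex ∈ W} ∪ {x ∈ W, Ex ∉ W}` (the chart intertwines the shifts only inside `W ∩ E⁻¹W`).  THIS FILE makes that exact and usable: (i) the identity, boundary operator in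
the tree's vocabulary (`mulOp` of the two layer indicators, `pull E`, `transplant`), forward and backward; (ii) CUT editions — `M_h` with `h` vanishing on the layer (every
partition function supported one step inside its window, (2.36) p. 229) kills the boundary operator EXACTLY, so the cube's entry-1 letter transplants VERBATIM; (iii) without a cut
the boundary operator is `≤ 1_H(y)·|n|·2A·1_W(y′)·K` from the cube's entry-0 letter `K`, any `H ⊇` layer, and one-step block-displacement letters `K(B(Ex), y′) ≤ A·K(B(x), y′)`
(global) ∕ `K(B′(E′x′), y′) ≤ A·K(B′(x′), y′)` (cube) — on King's torus blocks `A = e^{ρ}` for `K = B·e^{−ρ|y−y′|_T}` (§3).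

WHAT: §1 ★★ `fgrad_comp_transplant` ∕ ★★ `bgrad_comp_transplant` (the EXACT identities), `fgrad_transplant_apply_of_mem`, ★★ `mulOp_comp_fgrad_comp_transplant` ∕
`mulOp_comp_bgrad_comp_transplant` (CUT editions: no boundary term), `fgrad∕bgrad_comp_transplant_sub_eq_mulOp_comp` (the boundary operator LIVES on the layer); §2
`hasMaj_mulOp_comp_of_abs_le_one'`, `windowInd_le_one`, `windowInd_mul_le_of_disp`, `windowInd_mul_le_drop`, `hasMaj_mulOp_indicator_comp` (`M_{1_S}T ≤ 1_S(y)K`),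
★★ `hasMaj_mulOp_fgrad∕bgrad_comp_transplant` (cut editions: `1_W(y)1_W(y′)K₁` from the cube's entry-1 letter `K₁`), ★★ `hasMaj_fgrad∕bgrad_comp_transplant_sub` (the boundary
operator `≤ |n|·2A·1_W(y′)·K`), ★★ `hasMaj_fgrad∕bgrad_comp_transplant_sub_loc` (the same LOCALIZED `≤ 1_H(y)·…` — the `1_H(y)·m·K` currency of dag-n15-w3's defect slots
`mulOp_comp_sub_speciesOpM_comp_dressed_of_defect` ∕ `hasMaj_sandwich_separated`), ★ `hasMaj_fgrad_comp_transplant` (no cut: `1_W(y)1_W(y′)K₁ + |n|·2A·1_W(y′)K`); §3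
`exp_displacement_of_tdistT_le_one`, ★ `hasMaj_fgrad_comp_transplant_sub_kingTorus` (King's torus blocks on the global side, any shift moving the torus block by `≤ 1` — the unit
steps qualify by the lineage's `tdistT_blockOf_sub_unitVec_le`: `A = e^{ρ}`; the cube-side letter stays displayed).

HONEST FRAMING ∕ LIMITS.  Finite-lattice Leibniz ∕ support bookkeeping over the lit's transplant; ONE grid (the two-grid η-defect of the derivative entries is the composition of
this file with file 11 §2 and is NOT typed here); the window∕chart geometry (injective chart, blocks preserved on the window, shift compatibility inside the window) and the
cube's letters are DISPLAYED; the partition of unity and the resummation are dag-n15-c's files; nothing of [B6]∕[B9] asserted ((2.133) p. 247, (2.90)–(2.91) p. 239, p. 238, (2.36)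
p. 229 cited as SHAPES).  NE2⁺ NOT PRINTED ∕ NOT proved for d = 4; N15 NOT discharged; K3⁷ OPEN; counts UNMOVED (typed 28∕28 · discharged 5∕27, A 5∕28); one finite 𝕋⁴ at fixed
ε — NOT infinite volume, NOT OS on ℝ⁴, NOT a mass gap, NOT Clay; R4 closes the conditional finite-𝕋⁴ rung `BalabanLadder.UV` only.  Restate-immune (no Theses import).
-/

set_option autoImplicit false

noncomputable section
open scoped BigOperators
open Finset

namespace Summit.QuantumFields.YangMills.BalabanUVNodes.N15.CurvedSpecies

open Literature.MathematicalPhysics.QuantumFieldTheory.Balaban1983to89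
open Literature.MathematicalPhysics.QuantumFieldTheory.Balaban1983to89.B11SectG (BlockNorm HasMaj)
open Literature.MathematicalPhysics.QuantumFieldTheory.Balaban1983to89.B11AxialTransport190 (abs_le_loc_ofBlocks loc_ofBlocks_le)
open Literature.MathematicalPhysics.QuantumFieldTheory.Balaban1983to89.B6Prop26ReachTransplant (restrictOp extendOp transplant extendOp_apply transplant_apply)
open Literature.MathematicalPhysics.QuantumFieldTheory.Balaban1983to89.B6Prop26Gluing (mulOp mulOp_apply)
open Literature.MathematicalPhysics.QuantumFieldTheory.Balaban1983to89.T4EtaRateCoeffDefect (pull pull_apply)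
open Literature.MathematicalPhysics.QuantumFieldTheory.Balaban1983to89.B5Prop11Plancherel (Tor fine unitVec)
open Literature.MathematicalPhysics.QuantumFieldTheory.King1986.Torus (blockOf tdistT tdistT_nonneg tdistT_triangle tdistT_symm)
open Summit.QuantumFields.YangMills.BalabanUVNodes.N15.BackgroundLayer (fgrad bgrad fgrad_apply bgrad_apply)
open Literature.MathematicalPhysics.QuantumFieldTheory.Balaban1983to89.B6UnitTorusCarrier (unitTorusGeo)
open Summit.QuantumFields.YangMills.BalabanUVNodes.N15.VectorPiece (hasMaj_pull_comp tdistT_blockOf_sub_unitVec_le)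
open Summit.QuantumFields.YangMills.BalabanUVNodes.N15.TwoGrid (hasMaj_smul_ofBlocks)

/-! ## §1 The identity: global gradient past the transplant = transplanted cube gradient + boundary operator -/

section Identity

variable {X X' : Type} [DecidableEq X] [DecidableEq X']
variable (W : Finset X) (e : X → X') (E : X ≃ X) (E' : X' ≃ X') (n : ℝ) (T : Module.End ℝ (X' → ℝ))

/-- ★★ **THE FORWARD GRADIENT PAST A TRANSPLANTED CUBE OPERATOR.**  Window `W`, chart `e`, global shift `E`, cube shift `E′` with `e (E x) = E′ (e x)` whenever `x, Ex ∈ W`: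
`∇^n_E ∘ (ε T ρ) = ε (∇^n_{E′} ∘ T) ρ + n·(M_{1_{Wᶜ}} ∘ S_E ∘ ε T ρ − M_{1_{(E⁻¹W)ᶜ}} ∘ ε (S_{E′} ∘ T) ρ)` — the first boundary piece lives on `{x ∉ W, Ex ∈ W}`, the second on
`{x ∈ W, Ex ∉ W}` (EXACT; `S_E = pull E`, `ε(·)ρ = transplant W e ·`). [cite: Balaban1984PropagatorsII, (2.133) p.247, (2.90)–(2.91) p.239, p.238 (T_□) (shapes)] -/
theorem fgrad_comp_transplant (hcompat : ∀ x ∈ W, E x ∈ W → e (E x) = E' (e x)) :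
    fgrad n E ∘ₗ transplant W e T =
      transplant W e (fgrad n E' ∘ₗ T) +
        n • (mulOp (fun x => if x ∈ W then (0 : ℝ) else 1) ∘ₗ pull E ∘ₗ transplant W e T -
          mulOp (fun x => if E x ∈ W then (0 : ℝ) else 1) ∘ₗ transplant W e (pull E' ∘ₗ T)) := by
  refine LinearMap.ext fun f => funext fun x => ?_
  simp only [LinearMap.comp_apply, LinearMap.add_apply, LinearMap.smul_apply, LinearMap.sub_apply, Pi.add_apply, Pi.smul_apply, Pi.sub_apply, smul_eq_mul,
    fgrad_apply, transplant_apply, mulOp_apply, pull_apply]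
  by_cases hx : x ∈ W
  · by_cases hEx : E x ∈ W
    · rw [hcompat x hx hEx]; simp only [hx, hEx, if_true]; ring
    · simp only [hx, hEx, if_true, if_false]; ring
  · by_cases hEx : E x ∈ W
    · simp only [hx, hEx, if_true, if_false]; ring
    · simp only [hx, hEx, if_false]; ring

/-- ★★ **THE BACKWARD GRADIENT PAST A TRANSPLANTED CUBE OPERATOR**: `∇^{n,−}_E ∘ (ε T ρ) = ε (∇^{n,−}_{E′} ∘ T) ρ + n·(M_{1_{(EW)ᶜ}} ∘ ε (S_{E′}⁻¹ ∘ T) ρ − M_{1_{Wᶜ}} ∘ S_E⁻¹ ∘ ε T ρ)`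
(the pieces live on `{x ∈ W, E⁻¹x ∉ W}` ∕ `{x ∉ W, E⁻¹x ∈ W}`; same chart compatibility). [cite: Balaban1984PropagatorsII, (2.133) p.247 (shape); Balaban1985BackgroundPropagators, (3.52) p.400 (backward derivative: shape)] -/
theorem bgrad_comp_transplant (hcompat : ∀ x ∈ W, E x ∈ W → e (E x) = E' (e x)) :
    bgrad n E ∘ₗ transplant W e T =
      transplant W e (bgrad n E' ∘ₗ T) +
        n • (mulOp (fun x => if E.symm x ∈ W then (0 : ℝ) else 1) ∘ₗ transplant W e (pull E'.symm ∘ₗ T) -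
          mulOp (fun x => if x ∈ W then (0 : ℝ) else 1) ∘ₗ pull E.symm ∘ₗ transplant W e T) := by
  refine LinearMap.ext fun f => funext fun x => ?_
  simp only [LinearMap.comp_apply, LinearMap.add_apply, LinearMap.smul_apply, LinearMap.sub_apply, Pi.add_apply, Pi.smul_apply, Pi.sub_apply, smul_eq_mul,
    bgrad_apply, transplant_apply, mulOp_apply, pull_apply]
  by_cases hx : x ∈ W
  · by_cases hEx : E.symm x ∈ W
    · have hc : e x = E' (e (E.symm x)) := by have h := hcompat (E.symm x) hEx (by rwa [Equiv.apply_symm_apply]); rwa [Equiv.apply_symm_apply] at h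
      have hc' : E'.symm (e x) = e (E.symm x) := by rw [hc, Equiv.symm_apply_apply]
      rw [hc']; simp only [hx, hEx, if_true]; ring
    · simp only [hx, hEx, if_true, if_false]; ring
  · by_cases hEx : E.symm x ∈ W
    · simp only [hx, hEx, if_true, if_false]; ring
    · simp only [hx, hEx, if_false]; ring

/-- INSIDE THE WINDOW, ONE STEP FROM ITS EDGE, THE GLOBAL GRADIENT OF THE TRANSPLANT IS THE TRANSPLANTED CUBE GRADIENT, pointwise. [cite: Balaban1984PropagatorsII, p.238 (T_□), (2.133) p.247 (shape)] -/
theorem fgrad_transplant_apply_of_mem (hcompat : ∀ x ∈ W, E x ∈ W → e (E x) = E' (e x)) (f : X → ℝ) {x : X} (hx : x ∈ W) (hEx : E x ∈ W) :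
    fgrad n E (transplant W e T f) x = transplant W e (fgrad n E' ∘ₗ T) f x := by
  simp only [fgrad_apply, transplant_apply, LinearMap.comp_apply, if_pos hx, if_pos hEx, hcompat x hx hEx]

/-- ★★ **CUT EDITION, FORWARD: a factor vanishing on the layer kills the boundary operator** — if `h x = 0` whenever `x ∉ W` or `Ex ∉ W` (every partition function supported one
step inside its window), then `M_h ∘ ∇^n_E ∘ (ε T ρ) = M_h ∘ ε (∇^n_{E′} ∘ T) ρ` EXACTLY. [cite: Balaban1984PropagatorsII, (2.36) p.229, (2.90)–(2.91) p.239, (2.133) p.247 (shapes)] -/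
theorem mulOp_comp_fgrad_comp_transplant (hcompat : ∀ x ∈ W, E x ∈ W → e (E x) = E' (e x)) {h : X → ℝ} (hh : ∀ x, (x ∉ W ∨ E x ∉ W) → h x = 0) :
    mulOp h ∘ₗ (fgrad n E ∘ₗ transplant W e T) = mulOp h ∘ₗ transplant W e (fgrad n E' ∘ₗ T) := by
  refine LinearMap.ext fun f => funext fun x => ?_
  simp only [LinearMap.comp_apply, mulOp_apply]
  by_cases hx : x ∈ W
  · by_cases hEx : E x ∈ W
    · rw [fgrad_transplant_apply_of_mem W e E E' n T hcompat f hx hEx]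
    · rw [hh x (Or.inr hEx), zero_mul, zero_mul]
  · rw [hh x (Or.inl hx), zero_mul, zero_mul]

/-- ★★ **CUT EDITION, BACKWARD**: if `h x = 0` whenever `x ∉ W` or `E⁻¹x ∉ W`, then `M_h ∘ ∇^{n,−}_E ∘ (ε T ρ) = M_h ∘ ε (∇^{n,−}_{E′} ∘ T) ρ`. [cite: Balaban1984PropagatorsII, (2.36) p.229, (2.133) p.247 (shapes)] -/
theorem mulOp_comp_bgrad_comp_transplant (hcompat : ∀ x ∈ W, E x ∈ W → e (E x) = E' (e x)) {h : X → ℝ} (hh : ∀ x, (x ∉ W ∨ E.symm x ∉ W) → h x = 0) :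
    mulOp h ∘ₗ (bgrad n E ∘ₗ transplant W e T) = mulOp h ∘ₗ transplant W e (bgrad n E' ∘ₗ T) := by
  rw [bgrad_comp_transplant W e E E' n T hcompat, LinearMap.comp_add, add_eq_left, LinearMap.comp_smul, LinearMap.comp_sub]
  have h1 : mulOp h ∘ₗ (mulOp (fun x => if E.symm x ∈ W then (0 : ℝ) else 1) ∘ₗ transplant W e (pull E'.symm ∘ₗ T)) = 0 := by
    refine LinearMap.ext fun f => funext fun x => ?_
    rw [LinearMap.comp_apply, mulOp_apply, LinearMap.comp_apply, mulOp_apply, LinearMap.zero_apply, Pi.zero_apply]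
    by_cases hEx : E.symm x ∈ W
    · rw [if_pos hEx, zero_mul, mul_zero]
    · rw [hh x (Or.inr hEx), zero_mul]
  have h2 : mulOp h ∘ₗ (mulOp (fun x => if x ∈ W then (0 : ℝ) else 1) ∘ₗ pull E.symm ∘ₗ transplant W e T) = 0 := by
    refine LinearMap.ext fun f => funext fun x => ?_
    rw [LinearMap.comp_apply, mulOp_apply, LinearMap.comp_apply, mulOp_apply, LinearMap.zero_apply, Pi.zero_apply]
    by_cases hx : x ∈ W
    · rw [if_pos hx, zero_mul, mul_zero]
    · rw [hh x (Or.inl hx), zero_mul]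
  rw [h1, h2, sub_zero, smul_zero]

/-- THE FORWARD BOUNDARY OPERATOR LIVES ON THE LAYER: for any `H ⊇ {x ∉ W, Ex ∈ W} ∪ {x ∈ W, Ex ∉ W}`,
`∇^n_E ∘ (εTρ) − ε(∇^n_{E′}T)ρ = M_{1_H} ∘ (∇^n_E ∘ (εTρ) − ε(∇^n_{E′}T)ρ)` (EXACT). [cite: Balaban1984PropagatorsII, (2.133) p.247, p.238 (shapes)] -/
theorem fgrad_comp_transplant_sub_eq_mulOp_comp (hcompat : ∀ x ∈ W, E x ∈ W → e (E x) = E' (e x)) {H : Finset X}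
    (hH : ∀ x, (x ∉ W ∧ E x ∈ W) ∨ (x ∈ W ∧ E x ∉ W) → x ∈ H) :
    fgrad n E ∘ₗ transplant W e T - transplant W e (fgrad n E' ∘ₗ T) =
      mulOp (fun x => if x ∈ H then (1 : ℝ) else 0) ∘ₗ (fgrad n E ∘ₗ transplant W e T - transplant W e (fgrad n E' ∘ₗ T)) := by
  refine LinearMap.ext fun f => funext fun x => ?_
  rw [LinearMap.comp_apply, mulOp_apply]
  by_cases hxH : x ∈ H
  · rw [if_pos hxH, one_mul]
  rw [if_neg hxH, zero_mul, LinearMap.sub_apply, Pi.sub_apply]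
  simp only [LinearMap.comp_apply, fgrad_apply, transplant_apply]
  by_cases hx : x ∈ W
  · by_cases hEx : E x ∈ W
    · rw [hcompat x hx hEx]; simp only [hx, hEx, if_true]; ring
    · exact absurd (hH x (Or.inr ⟨hx, hEx⟩)) hxH
  · by_cases hEx : E x ∈ W
    · exact absurd (hH x (Or.inl ⟨hx, hEx⟩)) hxH
    · simp only [hx, hEx, if_false]; ring

/-- THE BACKWARD BOUNDARY OPERATOR LIVES ON THE LAYER `{x ∉ W, E⁻¹x ∈ W} ∪ {x ∈ W, E⁻¹x ∉ W}` (any `H` containing it). [cite: Balaban1984PropagatorsII, (2.133) p.247 (shape)] -/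
theorem bgrad_comp_transplant_sub_eq_mulOp_comp (hcompat : ∀ x ∈ W, E x ∈ W → e (E x) = E' (e x)) {H : Finset X}
    (hH : ∀ x, (x ∉ W ∧ E.symm x ∈ W) ∨ (x ∈ W ∧ E.symm x ∉ W) → x ∈ H) :
    bgrad n E ∘ₗ transplant W e T - transplant W e (bgrad n E' ∘ₗ T) =
      mulOp (fun x => if x ∈ H then (1 : ℝ) else 0) ∘ₗ (bgrad n E ∘ₗ transplant W e T - transplant W e (bgrad n E' ∘ₗ T)) := by
  refine LinearMap.ext fun f => funext fun x => ?_
  rw [LinearMap.comp_apply, mulOp_apply]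
  by_cases hxH : x ∈ H
  · rw [if_pos hxH, one_mul]
  rw [if_neg hxH, zero_mul, LinearMap.sub_apply, Pi.sub_apply]
  simp only [LinearMap.comp_apply, bgrad_apply, transplant_apply]
  by_cases hx : x ∈ W
  · by_cases hEx : E.symm x ∈ W
    · have hc : e x = E' (e (E.symm x)) := by have h := hcompat (E.symm x) hEx (by rwa [Equiv.apply_symm_apply]); rwa [Equiv.apply_symm_apply] at h
      have hc' : E'.symm (e x) = e (E.symm x) := by rw [hc, Equiv.symm_apply_apply]
      rw [hc']; simp only [hx, hEx, if_true]; ring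
    · exact absurd (hH x (Or.inr ⟨hx, hEx⟩)) hxH
  · by_cases hEx : E.symm x ∈ W
    · exact absurd (hH x (Or.inl ⟨hx, hEx⟩)) hxH
    · simp only [hx, hEx, if_false]; ring

end Identity

/-! ## §2 Majorants: the cut editions transplant the cube's entry-1 letter; the boundary operator costs the displacement letter -/

section Majorant

variable {g : B6.Geometry} {X X' : Type} [Fintype X] [Fintype X'] [DecidableEq X] [DecidableEq X']
variable (W : Finset X) (e : X → X') (E : X ≃ X) (E' : X' ≃ X') (n : ℝ) (T : Module.End ℝ (X' → ℝ)) (blk : X → g.Site) (blk' : X' → g.Site)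

omit [DecidableEq X] in
/-- A BOUNDED DIAGONAL ON THE LEFT costs nothing in the sharp-block currency (`|m| ≤ 1`; the lineage's `TwoGrid.hasMaj_mulOp_comp_of_abs_le_one` shape, re-proved here for
functions on a bare lattice to keep this file's imports light). [folklore] -/
theorem hasMaj_mulOp_comp_of_abs_le_one' {F₁ : Type} [AddCommGroup F₁] [Module ℝ F₁] {b₁ : BlockNorm g F₁} {S : F₁ →ₗ[ℝ] (X → ℝ)} {K : g.Site → g.Site → ℝ} {m : X → ℝ}
    (hm : ∀ x, |m x| ≤ 1) (hK : ∀ y y', 0 ≤ K y y') (h : HasMaj b₁ (BlockNorm.ofBlocks g blk) S K) :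
    HasMaj b₁ (BlockNorm.ofBlocks g blk) (mulOp m ∘ₗ S) K := by
  intro y' μ hμ y
  refine loc_ofBlocks_le blk _ (mul_nonneg (hK y y') (b₁.loc_nonneg y' μ)) fun x hx => ?_
  rw [LinearMap.comp_apply, mulOp_apply, abs_mul]
  exact (mul_le_of_le_one_left (abs_nonneg _) (hm x)).trans ((abs_le_loc_ofBlocks blk _ hx).trans (h y' μ hμ y))

omit [Fintype X] [Fintype X'] [DecidableEq X] [DecidableEq X'] in
/-- The layer indicators are `0 ∕ 1`-valued. [folklore] -/
theorem abs_ite_zero_one_le_one (P : Prop) [Decidable P] : |(if P then (0 : ℝ) else 1)| ≤ 1 := by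
  split_ifs <;> simp

omit [Fintype X] [Fintype X'] [DecidableEq X] [DecidableEq X'] in
/-- The window indicator is at most `1`. [folklore] -/
theorem windowInd_le_one (y : g.Site) : windowInd W blk y ≤ 1 := by
  unfold windowInd; split_ifs <;> norm_num

omit [Fintype X] [Fintype X'] [DecidableEq X] [DecidableEq X'] in
/-- The displacement step for the transplanted kernel: `1_W(B(sx))·1_W(y′)·K(B(sx), y′) ≤ A·(1_W(y′)·K(B(x), y′))` from `K(B(sx), y′) ≤ A·K(B(x), y′)`. [folklore] -/
theorem windowInd_mul_le_of_disp {s : X → X} {K : g.Site → g.Site → ℝ} (hK : ∀ a b, 0 ≤ K a b) {A : ℝ} (hdisp : ∀ x y', K (blk (s x)) y' ≤ A * K (blk x) y') (x : X) (y' : g.Site) :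
    windowInd W blk (blk (s x)) * windowInd W blk y' * K (blk (s x)) y' ≤ A * (windowInd W blk y' * K (blk x) y') := by
  have hw0 : 0 ≤ windowInd W blk y' := windowInd_nonneg _ _ _
  calc windowInd W blk (blk (s x)) * windowInd W blk y' * K (blk (s x)) y' ≤ 1 * windowInd W blk y' * K (blk (s x)) y' :=
        mul_le_mul_of_nonneg_right (mul_le_mul_of_nonneg_right (windowInd_le_one W blk _) hw0) (hK _ _)
    _ = windowInd W blk y' * K (blk (s x)) y' := by rw [one_mul]
    _ ≤ windowInd W blk y' * (A * K (blk x) y') := mul_le_mul_of_nonneg_left (hdisp x y') hw0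
    _ = A * (windowInd W blk y' * K (blk x) y') := by ring

omit [Fintype X] [Fintype X'] [DecidableEq X] [DecidableEq X'] in
/-- Dropping the output indicator: `1_W(y)·1_W(y′)·(A·K) ≤ A·(1_W(y′)·K)`. [folklore] -/
theorem windowInd_mul_le_drop {K : g.Site → g.Site → ℝ} (hK : ∀ a b, 0 ≤ K a b) {A : ℝ} (hA : 0 ≤ A) (y y' : g.Site) :
    windowInd W blk y * windowInd W blk y' * (A * K y y') ≤ A * (windowInd W blk y' * K y y') := by
  have hw0 : 0 ≤ windowInd W blk y' := windowInd_nonneg _ _ _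
  calc windowInd W blk y * windowInd W blk y' * (A * K y y') ≤ 1 * windowInd W blk y' * (A * K y y') :=
        mul_le_mul_of_nonneg_right (mul_le_mul_of_nonneg_right (windowInd_le_one W blk _) hw0) (mul_nonneg hA (hK _ _))
    _ = A * (windowInd W blk y' * K y y') := by ring

/-- ★★ **CUT EDITION, FORWARD — THE CUBE's ENTRY-1 LETTER TRANSPLANTS VERBATIM**: if `∇^n_{E′} ∘ T` has the cube majorant `K₁ ≥ 0` (chart injective on the window, blocks preserved,
shift compatibility) and `|h| ≤ 1` vanishes on the layer, then `M_h ∘ ∇^n_E ∘ (ε T ρ) ≤ 1_W(y)·1_W(y′)·K₁(y, y′)` — the (2.133) shape for the derivative entry, no boundary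
letter. [cite: Balaban1984PropagatorsII, (2.133) p.247, (2.36) p.229 (shapes)] -/
theorem hasMaj_mulOp_fgrad_comp_transplant (hinj : Set.InjOn e ↑W) (hblk : ∀ x ∈ W, blk' (e x) = blk x) (hcompat : ∀ x ∈ W, E x ∈ W → e (E x) = E' (e x))
    {h : X → ℝ} (hh : ∀ x, (x ∉ W ∨ E x ∉ W) → h x = 0) (hh1 : ∀ x, |h x| ≤ 1) {K₁ : g.Site → g.Site → ℝ} (hK₁ : ∀ a b, 0 ≤ K₁ a b)
    (hD : HasMaj (BlockNorm.ofBlocks g blk') (BlockNorm.ofBlocks g blk') (fgrad n E' ∘ₗ T) K₁) :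
    HasMaj (BlockNorm.ofBlocks g blk) (BlockNorm.ofBlocks g blk) (mulOp h ∘ₗ (fgrad n E ∘ₗ transplant W e T))
      (fun y y' => windowInd W blk y * windowInd W blk y' * K₁ y y') := by
  rw [mulOp_comp_fgrad_comp_transplant W e E E' n T hcompat hh]
  exact hasMaj_mulOp_comp_of_abs_le_one' blk hh1 (fun y y' => mul_nonneg (mul_nonneg (windowInd_nonneg _ _ _) (windowInd_nonneg _ _ _)) (hK₁ y y'))
    (hasMaj_transplant W e blk blk' hinj hblk hK₁ hD)

/-- ★★ **CUT EDITION, BACKWARD**: the same for `∇^{n,−}` with `h` vanishing on `{x ∉ W} ∪ {E⁻¹x ∉ W}`. [cite: Balaban1984PropagatorsII, (2.133) p.247 (shape); Balaban1985BackgroundPropagators, (3.52) p.400 (shape)] -/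
theorem hasMaj_mulOp_bgrad_comp_transplant (hinj : Set.InjOn e ↑W) (hblk : ∀ x ∈ W, blk' (e x) = blk x) (hcompat : ∀ x ∈ W, E x ∈ W → e (E x) = E' (e x))
    {h : X → ℝ} (hh : ∀ x, (x ∉ W ∨ E.symm x ∉ W) → h x = 0) (hh1 : ∀ x, |h x| ≤ 1) {K₁ : g.Site → g.Site → ℝ} (hK₁ : ∀ a b, 0 ≤ K₁ a b)
    (hD : HasMaj (BlockNorm.ofBlocks g blk') (BlockNorm.ofBlocks g blk') (bgrad n E' ∘ₗ T) K₁) :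
    HasMaj (BlockNorm.ofBlocks g blk) (BlockNorm.ofBlocks g blk) (mulOp h ∘ₗ (bgrad n E ∘ₗ transplant W e T))
      (fun y y' => windowInd W blk y * windowInd W blk y' * K₁ y y') := by
  rw [mulOp_comp_bgrad_comp_transplant W e E E' n T hcompat hh]
  exact hasMaj_mulOp_comp_of_abs_le_one' blk hh1 (fun y y' => mul_nonneg (mul_nonneg (windowInd_nonneg _ _ _) (windowInd_nonneg _ _ _)) (hK₁ y y'))
    (hasMaj_transplant W e blk blk' hinj hblk hK₁ hD)

/-- ★★ **THE BOUNDARY OPERATOR IS MAJORISED THROUGH THE DISPLACEMENT LETTERS.**  With the cube's entry-0 letter `K ≥ 0` for `T`, a global one-step letter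
`K(B(Ex), y′) ≤ A·K(B(x), y′)` and a cube one-step letter `K(B′(E′x′), y′) ≤ A·K(B′(x′), y′)` (`A ≥ 0`): `∇^n_E ∘ (εTρ) − ε(∇^n_{E′}T)ρ ≤ |n|·2A·1_W(y′)·K(y, y′)`.
[cite: Balaban1984PropagatorsII, (2.133) p.247, (2.52)–(2.55) pp.232–233 (block-majorant bookkeeping, shapes)] -/
theorem hasMaj_fgrad_comp_transplant_sub (hinj : Set.InjOn e ↑W) (hblk : ∀ x ∈ W, blk' (e x) = blk x) (hcompat : ∀ x ∈ W, E x ∈ W → e (E x) = E' (e x))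
    {K : g.Site → g.Site → ℝ} (hK : ∀ a b, 0 ≤ K a b) {A : ℝ} (hA : 0 ≤ A) (hdisp : ∀ x y', K (blk (E x)) y' ≤ A * K (blk x) y')
    (hdisp' : ∀ x' y', K (blk' (E' x')) y' ≤ A * K (blk' x') y') (hT : HasMaj (BlockNorm.ofBlocks g blk') (BlockNorm.ofBlocks g blk') T K) :
    HasMaj (BlockNorm.ofBlocks g blk) (BlockNorm.ofBlocks g blk) (fgrad n E ∘ₗ transplant W e T - transplant W e (fgrad n E' ∘ₗ T))
      (fun y y' => |n| * (2 * A) * (windowInd W blk y' * K y y')) := by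
  rw [fgrad_comp_transplant W e E E' n T hcompat, add_sub_cancel_left]
  have hwK : ∀ y y', 0 ≤ A * (windowInd W blk y' * K y y') := fun y y' => mul_nonneg hA (mul_nonneg (windowInd_nonneg _ _ _) (hK y y'))
  -- the outgoing piece: `S_E` past the transplanted `T` costs the GLOBAL displacement letter
  have h1 : HasMaj (BlockNorm.ofBlocks g blk) (BlockNorm.ofBlocks g blk) (mulOp (fun x => if x ∈ W then (0 : ℝ) else 1) ∘ₗ pull E ∘ₗ transplant W e T)
      (fun y y' => A * (windowInd W blk y' * K y y')) := by
    refine hasMaj_mulOp_comp_of_abs_le_one' blk (fun x => abs_ite_zero_one_le_one _) hwK ?_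
    exact hasMaj_pull_comp blk E hwK (windowInd_mul_le_of_disp W blk hK hdisp) (hasMaj_transplant W e blk blk' hinj hblk hK hT)
  -- the incoming piece: `S_{E′}` past `T` on the cube costs the CUBE displacement letter, then transplants
  have h2 : HasMaj (BlockNorm.ofBlocks g blk) (BlockNorm.ofBlocks g blk) (mulOp (fun x => if E x ∈ W then (0 : ℝ) else 1) ∘ₗ transplant W e (pull E' ∘ₗ T))
      (fun y y' => A * (windowInd W blk y' * K y y')) := by
    refine hasMaj_mulOp_comp_of_abs_le_one' blk (fun x => abs_ite_zero_one_le_one _) hwK ?_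
    have hloc : HasMaj (BlockNorm.ofBlocks g blk') (BlockNorm.ofBlocks g blk') (pull E' ∘ₗ T) (fun y y' => A * K y y') :=
      hasMaj_pull_comp blk' E' (fun y y' => mul_nonneg hA (hK y y')) hdisp' hT
    exact (hasMaj_transplant W e blk blk' hinj hblk (fun y y' => mul_nonneg hA (hK y y')) hloc).mono (windowInd_mul_le_drop W blk hK hA)
  refine (hasMaj_smul_ofBlocks blk (fun y y' => add_nonneg (hwK y y') (hwK y y')) n (h1.sub h2)).mono fun y y' => le_of_eq ?_
  ring

/-- ★★ **THE BACKWARD BOUNDARY OPERATOR**, same letters with the inverse shifts: `∇^{n,−}_E ∘ (εTρ) − ε(∇^{n,−}_{E′}T)ρ ≤ |n|·2A·1_W(y′)·K(y, y′)`.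
[cite: Balaban1984PropagatorsII, (2.133) p.247, (2.52)–(2.55) pp.232–233 (shapes)] -/
theorem hasMaj_bgrad_comp_transplant_sub (hinj : Set.InjOn e ↑W) (hblk : ∀ x ∈ W, blk' (e x) = blk x) (hcompat : ∀ x ∈ W, E x ∈ W → e (E x) = E' (e x))
    {K : g.Site → g.Site → ℝ} (hK : ∀ a b, 0 ≤ K a b) {A : ℝ} (hA : 0 ≤ A) (hdisp : ∀ x y', K (blk (E.symm x)) y' ≤ A * K (blk x) y')
    (hdisp' : ∀ x' y', K (blk' (E'.symm x')) y' ≤ A * K (blk' x') y') (hT : HasMaj (BlockNorm.ofBlocks g blk') (BlockNorm.ofBlocks g blk') T K) :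
    HasMaj (BlockNorm.ofBlocks g blk) (BlockNorm.ofBlocks g blk) (bgrad n E ∘ₗ transplant W e T - transplant W e (bgrad n E' ∘ₗ T))
      (fun y y' => |n| * (2 * A) * (windowInd W blk y' * K y y')) := by
  rw [bgrad_comp_transplant W e E E' n T hcompat, add_sub_cancel_left]
  have hwK : ∀ y y', 0 ≤ A * (windowInd W blk y' * K y y') := fun y y' => mul_nonneg hA (mul_nonneg (windowInd_nonneg _ _ _) (hK y y'))
  have h1 : HasMaj (BlockNorm.ofBlocks g blk) (BlockNorm.ofBlocks g blk) (mulOp (fun x => if E.symm x ∈ W then (0 : ℝ) else 1) ∘ₗ transplant W e (pull E'.symm ∘ₗ T))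
      (fun y y' => A * (windowInd W blk y' * K y y')) := by
    refine hasMaj_mulOp_comp_of_abs_le_one' blk (fun x => abs_ite_zero_one_le_one _) hwK ?_
    have hloc : HasMaj (BlockNorm.ofBlocks g blk') (BlockNorm.ofBlocks g blk') (pull E'.symm ∘ₗ T) (fun y y' => A * K y y') :=
      hasMaj_pull_comp blk' E'.symm (fun y y' => mul_nonneg hA (hK y y')) hdisp' hT
    exact (hasMaj_transplant W e blk blk' hinj hblk (fun y y' => mul_nonneg hA (hK y y')) hloc).mono (windowInd_mul_le_drop W blk hK hA)
  have h2 : HasMaj (BlockNorm.ofBlocks g blk) (BlockNorm.ofBlocks g blk) (mulOp (fun x => if x ∈ W then (0 : ℝ) else 1) ∘ₗ pull E.symm ∘ₗ transplant W e T)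
      (fun y y' => A * (windowInd W blk y' * K y y')) := by
    refine hasMaj_mulOp_comp_of_abs_le_one' blk (fun x => abs_ite_zero_one_le_one _) hwK ?_
    exact hasMaj_pull_comp blk E.symm hwK (windowInd_mul_le_of_disp W blk hK hdisp) (hasMaj_transplant W e blk blk' hinj hblk hK hT)
  refine (hasMaj_smul_ofBlocks blk (fun y y' => add_nonneg (hwK y y') (hwK y y')) n (h1.sub h2)).mono fun y y' => le_of_eq ?_
  ring

/-- AN INDICATOR ON THE LEFT INSERTS ITS BLOCK INDICATOR INTO THE MAJORANT: `M_{1_S} ∘ T ≤ 1_S(y)·K(y, y′)` (`1_S(y)` = file 11's `windowInd S`: the blocks met by `S`).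
[cite: Balaban1984PropagatorsII, (2.133) p.247 (shape)] -/
theorem hasMaj_mulOp_indicator_comp {F₁ : Type} [AddCommGroup F₁] [Module ℝ F₁] {b₁ : BlockNorm g F₁} {S : Finset X} {R : F₁ →ₗ[ℝ] (X → ℝ)} {K : g.Site → g.Site → ℝ}
    (hK : ∀ y y', 0 ≤ K y y') (h : HasMaj b₁ (BlockNorm.ofBlocks g blk) R K) :
    HasMaj b₁ (BlockNorm.ofBlocks g blk) (mulOp (fun x => if x ∈ S then (1 : ℝ) else 0) ∘ₗ R) (fun y y' => windowInd S blk y * K y y') := by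
  intro y' μ hμ y
  dsimp only
  by_cases hS : ∃ x ∈ S, blk x = y
  · rw [windowInd_of_mem hS.choose_spec.1 hS.choose_spec.2, one_mul]
    exact hasMaj_mulOp_comp_of_abs_le_one' blk (fun x => by split_ifs <;> simp) hK h y' μ hμ y
  · rw [windowInd_of_not hS, zero_mul, zero_mul]
    refine loc_ofBlocks_le blk _ le_rfl fun x hx => ?_
    rw [LinearMap.comp_apply, mulOp_apply, if_neg (fun hxS => hS ⟨x, hxS, hx⟩), zero_mul, abs_zero]

/-- ★★ **THE BOUNDARY OPERATOR, LOCALIZED ON THE LAYER (the `1_H(y)·m·K` currency of the gluing's defect slots).**  For any `H ⊇ {x ∉ W, Ex ∈ W} ∪ {x ∈ W, Ex ∉ W}`: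
`∇^n_E ∘ (εTρ) − ε(∇^n_{E′}T)ρ ≤ 1_H(y)·|n|·2A·1_W(y′)·K(y, y′)`. [cite: Balaban1984PropagatorsII, (2.133) p.247, (2.52)–(2.55) pp.232–233 (shapes)] -/
theorem hasMaj_fgrad_comp_transplant_sub_loc (hinj : Set.InjOn e ↑W) (hblk : ∀ x ∈ W, blk' (e x) = blk x) (hcompat : ∀ x ∈ W, E x ∈ W → e (E x) = E' (e x))
    {H : Finset X} (hH : ∀ x, (x ∉ W ∧ E x ∈ W) ∨ (x ∈ W ∧ E x ∉ W) → x ∈ H)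
    {K : g.Site → g.Site → ℝ} (hK : ∀ a b, 0 ≤ K a b) {A : ℝ} (hA : 0 ≤ A) (hdisp : ∀ x y', K (blk (E x)) y' ≤ A * K (blk x) y')
    (hdisp' : ∀ x' y', K (blk' (E' x')) y' ≤ A * K (blk' x') y') (hT : HasMaj (BlockNorm.ofBlocks g blk') (BlockNorm.ofBlocks g blk') T K) :
    HasMaj (BlockNorm.ofBlocks g blk) (BlockNorm.ofBlocks g blk) (fgrad n E ∘ₗ transplant W e T - transplant W e (fgrad n E' ∘ₗ T))
      (fun y y' => windowInd H blk y * (|n| * (2 * A) * (windowInd W blk y' * K y y'))) := by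
  rw [fgrad_comp_transplant_sub_eq_mulOp_comp W e E E' n T hcompat hH]
  exact hasMaj_mulOp_indicator_comp blk (fun y y' => by have := windowInd_nonneg W blk y'; have := hK y y'; positivity)
    (hasMaj_fgrad_comp_transplant_sub W e E E' n T blk blk' hinj hblk hcompat hK hA hdisp hdisp' hT)

/-- ★★ **THE BACKWARD BOUNDARY OPERATOR, LOCALIZED** on any `H ⊇ {x ∉ W, E⁻¹x ∈ W} ∪ {x ∈ W, E⁻¹x ∉ W}`. [cite: Balaban1984PropagatorsII, (2.133) p.247 (shape)] -/
theorem hasMaj_bgrad_comp_transplant_sub_loc (hinj : Set.InjOn e ↑W) (hblk : ∀ x ∈ W, blk' (e x) = blk x) (hcompat : ∀ x ∈ W, E x ∈ W → e (E x) = E' (e x))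
    {H : Finset X} (hH : ∀ x, (x ∉ W ∧ E.symm x ∈ W) ∨ (x ∈ W ∧ E.symm x ∉ W) → x ∈ H)
    {K : g.Site → g.Site → ℝ} (hK : ∀ a b, 0 ≤ K a b) {A : ℝ} (hA : 0 ≤ A) (hdisp : ∀ x y', K (blk (E.symm x)) y' ≤ A * K (blk x) y')
    (hdisp' : ∀ x' y', K (blk' (E'.symm x')) y' ≤ A * K (blk' x') y') (hT : HasMaj (BlockNorm.ofBlocks g blk') (BlockNorm.ofBlocks g blk') T K) :
    HasMaj (BlockNorm.ofBlocks g blk) (BlockNorm.ofBlocks g blk) (bgrad n E ∘ₗ transplant W e T - transplant W e (bgrad n E' ∘ₗ T))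
      (fun y y' => windowInd H blk y * (|n| * (2 * A) * (windowInd W blk y' * K y y'))) := by
  rw [bgrad_comp_transplant_sub_eq_mulOp_comp W e E E' n T hcompat hH]
  exact hasMaj_mulOp_indicator_comp blk (fun y y' => by have := windowInd_nonneg W blk y'; have := hK y y'; positivity)
    (hasMaj_bgrad_comp_transplant_sub W e E E' n T blk blk' hinj hblk hcompat hK hA hdisp hdisp' hT)

/-- ★ **THE GLOBAL ENTRY-1 ROW OF A TRANSPLANTED CUBE OPERATOR, NO CUT**: the cube's entry-1 letter `K₁` transplanted plus the boundary operator: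
`∇^n_E ∘ (εTρ) ≤ 1_W(y)1_W(y′)K₁ + |n|·2A·1_W(y′)K`. [cite: Balaban1984PropagatorsII, (2.133) p.247 (shape)] -/
theorem hasMaj_fgrad_comp_transplant (hinj : Set.InjOn e ↑W) (hblk : ∀ x ∈ W, blk' (e x) = blk x) (hcompat : ∀ x ∈ W, E x ∈ W → e (E x) = E' (e x))
    {K K₁ : g.Site → g.Site → ℝ} (hK : ∀ a b, 0 ≤ K a b) (hK₁ : ∀ a b, 0 ≤ K₁ a b) {A : ℝ} (hA : 0 ≤ A) (hdisp : ∀ x y', K (blk (E x)) y' ≤ A * K (blk x) y')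
    (hdisp' : ∀ x' y', K (blk' (E' x')) y' ≤ A * K (blk' x') y') (hT : HasMaj (BlockNorm.ofBlocks g blk') (BlockNorm.ofBlocks g blk') T K)
    (hD : HasMaj (BlockNorm.ofBlocks g blk') (BlockNorm.ofBlocks g blk') (fgrad n E' ∘ₗ T) K₁) :
    HasMaj (BlockNorm.ofBlocks g blk) (BlockNorm.ofBlocks g blk) (fgrad n E ∘ₗ transplant W e T)
      (fun y y' => windowInd W blk y * windowInd W blk y' * K₁ y y' + |n| * (2 * A) * (windowInd W blk y' * K y y')) := by
  have h := (hasMaj_transplant W e blk blk' hinj hblk hK₁ hD).add (hasMaj_fgrad_comp_transplant_sub W e E E' n T blk blk' hinj hblk hcompat hK hA hdisp hdisp' hT)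
  rw [add_sub_cancel] at h
  exact h

end Majorant

/-! ## §3 King's torus blocks on the global side: the displacement letter is `e^{ρ}` -/

section Torus

/-- THE DISPLACEMENT LETTER OF AN EXPONENTIAL KERNEL: if the shifted block is within torus distance `1` of the original one, `B·e^{−ρ|s(y)−y′|} ≤ e^{ρ}·B·e^{−ρ|y−y′|}` (`B, ρ ≥ 0`).
[cite: Balaban1984PropagatorsII, (2.52)–(2.55) pp.232–233 (shape)] -/
theorem exp_displacement_of_tdistT_le_one {d : ℕ} (M : Fin (d + 1) → ℕ) [∀ μ, NeZero (M μ)] {B ρ : ℝ} (hB : 0 ≤ B) (hρ : 0 ≤ ρ) {y ys y' : Tor M}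
    (hs : tdistT M ys y ≤ 1) :
    B * Real.exp (-(ρ * tdistT M ys y')) ≤ Real.exp ρ * (B * Real.exp (-(ρ * tdistT M y y'))) := by
  rw [← mul_assoc, mul_comm (Real.exp ρ) B, mul_assoc, ← Real.exp_add]
  refine mul_le_mul_of_nonneg_left (Real.exp_le_exp.mpr ?_) hB
  have h1 := tdistT_triangle M y ys y'
  rw [tdistT_symm] at hs
  nlinarith

variable {d : ℕ} {L : ℕ} (M : Fin (d + 1) → ℕ) [∀ μ, NeZero (M μ)] (k m : ℕ) [NeZero m]
variable {X' ι : Type} [Fintype X'] [DecidableEq X'] [Fintype ι] [DecidableEq ι]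
variable (W : Finset (Tor (fine m M) × ι)) (e : Tor (fine m M) × ι → X') (E : (Tor (fine m M) × ι) ≃ (Tor (fine m M) × ι)) (E' : X' ≃ X') (n : ℝ)
  (T : Module.End ℝ (X' → ℝ)) (blk' : X' → Tor M)

/-- ★ **THE BOUNDARY OPERATOR ON KING's TORUS BLOCKS.**  Global lattice `Tor (fine m M) × ι` (vector∕matrix-valued fields read as scalar fields on the product), blocks
`B = blockOf m M ∘ fst` into the unit-torus carrier, a global shift `E` moving the torus coordinate by at most one block (`|B((Ex)₁) − B(x₁)|_T ≤ 1` — for the unit steps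
`x ↦ (x₁ ∓ e_κ, x₂)` this is the lineage's `tdistT_blockOf_sub_unitVec_le`), cube letter `K = B·e^{−ρ|y−y′|_T}`: the global displacement letter is `A = e^{ρ}`, the cube's stays
displayed — `∇^n_E ∘ (εTρ) − ε(∇^n_{E′}T)ρ ≤ |n|·2e^{ρ}·1_W(y′)·B·e^{−ρ|y−y′|_T}`. [cite: Balaban1984PropagatorsII, (2.133) p.247, (2.52)–(2.55) pp.232–233 (shapes); King1986, p.664 (pairing convention)] -/
theorem hasMaj_fgrad_comp_transplant_sub_kingTorus (hinj : Set.InjOn e ↑W) (hblk : ∀ x ∈ W, blk' (e x) = blockOf m M x.1)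
    (hcompat : ∀ x ∈ W, E x ∈ W → e (E x) = E' (e x)) (hE : ∀ x, tdistT M (blockOf m M (E x).1) (blockOf m M x.1) ≤ 1)
    {B ρ : ℝ} (hB : 0 ≤ B) (hρ : 0 ≤ ρ)
    (hdisp' : ∀ x' y', B * Real.exp (-(ρ * tdistT M (blk' (E' x')) y')) ≤ Real.exp ρ * (B * Real.exp (-(ρ * tdistT M (blk' x') y'))))
    (hT : HasMaj (BlockNorm.ofBlocks (unitTorusGeo L k M) blk') (BlockNorm.ofBlocks (unitTorusGeo L k M) blk') T (fun y y' => B * Real.exp (-(ρ * tdistT M y y')))) :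
    HasMaj (BlockNorm.ofBlocks (unitTorusGeo L k M) (fun x : Tor (fine m M) × ι => blockOf m M x.1))
      (BlockNorm.ofBlocks (unitTorusGeo L k M) (fun x : Tor (fine m M) × ι => blockOf m M x.1))
      (fgrad n E ∘ₗ transplant W e T - transplant W e (fgrad n E' ∘ₗ T))
      (fun y y' => |n| * (2 * Real.exp ρ) * (windowInd W (fun x : Tor (fine m M) × ι => blockOf m M x.1) y' * (B * Real.exp (-(ρ * tdistT M y y'))))) :=
  hasMaj_fgrad_comp_transplant_sub (g := unitTorusGeo L k M) W e E E' n T (fun x : Tor (fine m M) × ι => blockOf m M x.1) blk' hinj hblk hcompat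
    (K := fun y y' => B * Real.exp (-(ρ * tdistT M y y'))) (fun _ _ => mul_nonneg hB (Real.exp_nonneg _)) (A := Real.exp ρ) (Real.exp_nonneg ρ)
    (fun x _ => exp_displacement_of_tdistT_le_one M hB hρ (hE x)) hdisp' hT

end Torus

end Summit.QuantumFields.YangMills.BalabanUVNodes.N15.CurvedSpecies

end
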